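import Summits.QuantumFields.BalabanUV.T4Continuum.Spine.NE7cSmoothingLocal

/-!
# T⁴ programme, spine node NE7c (U5b) — ROAD P3 «SMOOTHING»: the LOCALISED remainder sandwich feeds the seam-(ζ′) tail socket
# (END-S-local, kernel) — the supplier-facing form of node U5b's `hsw` under design (η)

Cell `pub-balaban`, BINDER-OWNERS row NE7c, co-owner #3 = unit `b2b-balaban-t4-ne7c-p3` (GEN 2), skeleton
`HOME/t4/skeletons/NE7c-t4-ne7c-p3.md` §1/§4 (item «WHERE R IS LOAD-BEARING»).  Companion of `Spine/NE7cSmoothingLocal`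
(p208168: with the GLOBAL `hsw` the η-layer's letters are inert; the LOCALISED binder `hswL` makes the window shell load-bearing)
and `Spine/NE7cSmoothingSocket` (p207756: END-R in the tail socket, budget on the common min-cores `coreW`).

WHAT THIS MODULE ADDS (all [folklore], 0 sorry, compositions by name).  The seam-(ζ′) socket consumes node U5b's good-class data as
a `T4MatchingClosure.ReindexedBudget` (per good term: nonnegativity and a two-sided sandwich of the hybrid cores with a TERM
constant `Cc` and radius `Rr`, plus NE-R1's four constant clauses).  §1 `reindexedBudget_coreW_of_local`: that structure ON THE
COMMON MIN-CORES `coreW^A`, `coreW^B` of a represented pair of runs is OBTAINED from a remainder sandwich that holds ONLY on each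
good term's JOINT POLARITY EVENT (every declared letter «on» in both runs — the common small-field region for small letters),
`e^{Cc − Rr} R^A ≤ R^B ≤ e^{Cc + Rr} R^A` a.e. THERE, together with the four constant clauses copied verbatim: off the event the
min-core vanishes (`NE7cSmoothingLocal.integral_mul_sandwich_on`, `facAt_ne_zero_of_coreAt_ne_zero`).  §2
`hybridNE7_tail_patterned_of_localBudget`: for the (η)-layer of the two runs — END-S (`NE7cSmoothingSocket.
hybridNE7_tail_patterned_of_localRate_coreW`) ∘ §1 with the layer's window representations: `∃ K₀, HybridNE7 …` for the
shifted layer families from END-R's binders (NE3's `LocalRate` etc.), row NE7b's `RelWeightBound` on the layer, the LOCALISED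
old-density sandwich with term constants, NE-R1's clauses and four summable rates.  This is the supplier-facing statement of
what node U5b owes under design (η): the old densities' two-run sandwich on the COMMON SMALL-FIELD∕declared-polarity region of the
window ONLY — the complement is paid by the shell weight R (END-W∕END-R, p206673).

HONEST FRAMING.  Bookkeeping over binders; nothing of Bałaban's asserted; the localised sandwich, NE-R1's clauses, NE7b's bound and
NE3's rate are other rows'/nodes' inputs BY NAME; the (o1) instantiation (NODE O) and the ruling Lq-P3-2 (binder shape of `hsw`)
are pending.  FIXED finite T⁴, rung (B)+1; NOT infinite volume, NOT a mass gap, NOT Clay, NOT summit progress; spine 0/9.  HONEST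
DEPENDENCY: continuum YM on T⁴ ⇐ BetaPertH ∧ nine spine estimates (0/9 proved); BetaPertH ⇐ (D1) ∧ (D4) ∧ CAP+tail; G-an2-4
gates asym, D1 and NE2/3/4.
-/

noncomputable section

open MeasureTheory Finset Filter
open scoped NNReal ENNReal

namespace Summit.QuantumFields.BalabanUV.T4Continuum.NE7cSmoothingLocalSocket

open Literature.MathematicalPhysics.QuantumFieldTheory.Balaban1983to89
open T4Continuum T4LevelShift T4AveragingDisintegration T4WindowLevelShift T4LipschitzLedger T4FiniteEpsInhabited
  BlockAveraging ExpMeanLog T4FinestToWindow T4AgeZeroLayer T4PatternLayer T4SupCloseLiaison T4EtaRateMin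
open T4IndicatorShell T4LipschitzCutoff T4WeightBudget T4HybridMatching T4MatchingAssembly T4MatchingClosure
open Summit.QuantumFields.BalabanUV.T4Continuum.NE7cSmoothing Summit.QuantumFields.BalabanUV.T4Continuum.NE7cSmoothingSocket
  Summit.QuantumFields.BalabanUV.T4Continuum.NE7cSmoothingLocal

/-! ## §1 Generic ledger: a `ReindexedBudget` on the common min-cores from the LOCALISED remainder sandwich -/

section Generic

variable {ι : Type*} [DecidableEq ι] {Ω : ℕ → ι → Type*} [∀ K τ, MeasurableSpace (Ω K τ)]
  {l₀ vol : ℝ} {T : ℕ → Finset ι} {A B : ℕ → ℝ → ι → ℝ} {χ : ℕ → ℝ → ℝ} {κ Lχ : ℕ → ℝ} {N : ℕ} {n : ℕ → ℕ}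
  {μ : (K : ℕ) → (τ : ι) → Measure (Ω K τ)} {m : ℕ → ι → ℕ} {slot : ℕ → ι → ℕ → Σ _ : ℕ, ℕ}
  {pol : ℕ → ι → ℕ → Pol} {θ : ℕ → ι → ℕ → ℝ} {uA uB : (K : ℕ) → (τ : ι) → ℕ → Ω K τ → ℝ}
  {RA RB : (K : ℕ) → ℝ → (τ : ι) → Ω K τ → ℝ} {Bad : ℕ → ℝ → Finset ι}
  {Cc Rr CcRec RrRec : ℕ → ℝ → ι → ℝ} {ν u s₂ c₀ r s : ℕ → ℝ}

/-- **THE SOCKET's BUDGET ON THE COMMON MIN-CORES FROM THE LOCALISED REMAINDER SANDWICH.**  Two represented runs; on every good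
term the remainders sandwiched with the term's constant `Cc K t τ` and radius `Rr K t τ` a.e. ON THE JOINT POLARITY EVENT ONLY;
NE-R1's four constant clauses (`uv_const`, `uv_radius`, `recent_remainder`, `recent_deviation`) as binders ⇒
`ReindexedBudget l₀ vol T coreW^A coreW^B Bad Cc Rr CcRec RrRec ν u s₂ c₀ r s` — the input `h` of
`NE7cSmoothingSocket.hybridNE7_tail_patterned_of_localRate_coreW` / `T4LipschitzLedgerSocket.reindexedBudget_of_coreW`. [folklore] -/
theorem reindexedBudget_coreW_of_local (hA : TermRepr l₀ T A χ κ Lχ N n μ m slot pol θ uA uB RA)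
    (hB : TermRepr l₀ T B χ κ Lχ N n μ m slot pol θ uB uA RB)
    (hswL : ∀ K t, |t| ≤ l₀ → ∀ τ ∈ T K \ Bad K t,
      (∀ᵐ v ∂(μ K τ), (∀ i < m K τ, facAt χ (slot K τ) (pol K τ) (θ K τ) (fun j => uA K τ j v) i ≠ 0 ∧
          facAt χ (slot K τ) (pol K τ) (θ K τ) (fun j => uB K τ j v) i ≠ 0) →
        Real.exp (Cc K t τ - Rr K t τ) * RA K t τ v ≤ RB K t τ v) ∧
      (∀ᵐ v ∂(μ K τ), (∀ i < m K τ, facAt χ (slot K τ) (pol K τ) (θ K τ) (fun j => uA K τ j v) i ≠ 0 ∧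
          facAt χ (slot K τ) (pol K τ) (θ K τ) (fun j => uB K τ j v) i ≠ 0) →
        RB K t τ v ≤ Real.exp (Cc K t τ + Rr K t τ) * RA K t τ v))
    (huv : ∀ K t, |t| ≤ l₀ → ∀ τ ∈ T K \ Bad K t, |Cc K t τ - (CcRec K t τ + ν K)| ≤ vol * s₂ K)
    (hur : ∀ K t, |t| ≤ l₀ → ∀ τ ∈ T K \ Bad K t, Rr K t τ ≤ RrRec K t τ + vol * u K)
    (hrr : ∀ K t, |t| ≤ l₀ → ∀ τ ∈ T K \ Bad K t, RrRec K t τ ≤ vol * r K)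
    (hdev : ∀ K t, |t| ≤ l₀ → ∀ τ ∈ T K \ Bad K t, |CcRec K t τ - c₀ K| ≤ vol * s K) :
    ReindexedBudget l₀ vol T (coreW χ μ m slot pol θ uA uB RA) (coreW χ μ m slot pol θ uB uA RB) Bad Cc Rr CcRec RrRec
      ν u s₂ c₀ r s := by
  -- per good term: the localised sandwich integrates against the common nonnegative min-core
  have key : ∀ K t, |t| ≤ l₀ → ∀ τ ∈ T K \ Bad K t,
      Real.exp (Cc K t τ - Rr K t τ) * coreW χ μ m slot pol θ uA uB RA K t τ ≤ coreW χ μ m slot pol θ uB uA RB K t τ ∧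
        coreW χ μ m slot pol θ uB uA RB K t τ ≤ Real.exp (Cc K t τ + Rr K t τ) * coreW χ μ m slot pol θ uA uB RA K t τ := by
    intro K t ht τ hτ
    have hτT : τ ∈ T K := (Finset.mem_sdiff.1 hτ).1
    obtain ⟨hlo, hhi⟩ := hswL K t ht τ hτ
    have hIB : Integrable (fun v => coreAt χ (slot K τ) (pol K τ) (θ K τ) (fun j => uA K τ j v) (fun j => uB K τ j v)
        (m K τ) * RB K t τ v) (μ K τ) := by
      refine (hB.integrable_core ht hτT (K := K)).congr (ae_of_all _ fun v => ?_)
      simp only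
      rw [coreAt_comm]
    rw [coreW_comm (uA := uA) (uB := uB) (RB := RB) K t τ]
    unfold coreW
    refine integral_mul_sandwich_on (fun v => coreAt_nonneg hA.profile) (hA.integrable_core ht hτT) hIB ?_ ?_
    · filter_upwards [hlo] with v hv hne
      exact hv (facAt_ne_zero_of_coreAt_ne_zero hA.profile hne)
    · filter_upwards [hhi] with v hv hne
      exact hv (facAt_ne_zero_of_coreAt_ne_zero hA.profile hne)
  exact
    { nonneg := fun K t ht τ hτ => by
        unfold coreW
        refine integral_nonneg_of_ae ?_
        filter_upwards [hA.rem_nonneg K t ht τ (Finset.mem_sdiff.1 hτ).1] with v hv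
        exact mul_nonneg (coreAt_nonneg hA.profile) hv
      lower := fun K t ht τ hτ => (key K t ht τ hτ).1
      upper := fun K t ht τ hτ => (key K t ht τ hτ).2
      uv_const := huv
      uv_radius := hur
      recent_remainder := hrr
      recent_deviation := hdev }

end Generic

/-! ## §2 The (η)-layer of the two runs: END-S from END-R's binders + NE7b + the LOCALISED old-density sandwich + NE-R1's clauses -/

section Layer

variable {ι₀ Dat Sit : Type*} [DecidableEq ι₀] {N : ℕ} [NeZero N] (F : T4Family)

/-- **END-S-local — ROAD P3 THROUGH THE TAIL SOCKET WITH THE LOCALISED OLD-DENSITY SANDWICH.**  END-R's binders (profiles; data;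
threshold floor; measurable window functionals; node U1b's `LocalRate` + `ReadsLevels`; older weights), row NE7b's `RelWeightBound` on
the layer, node U5b's old-density sandwich with TERM constants `Cc`/`Rr` holding ONLY on each good layered term's joint polarity event
(the common small-field region of its declared window letters for small polarities), NE-R1's four constant clauses, four summable
rates ⇒ `∃ K₀, HybridNE7 …` for the `K₀`-shifted (η)-layer.  (`reindexedBudget_coreW_of_local` ∘ the window representations of
p207756 ∘ `hybridNE7_tail_patterned_of_localRate_coreW`.) [folklore] -/
theorem hybridNE7_tail_patterned_of_localBudget {l₀ vol : ℝ} {T₀ : ℕ → Finset ι₀} {R : Readings Dat Sit} {C ϑ θmin : ℝ}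
    {χ : ℕ → ℝ → ℝ} {κ Lχ : ℕ → ℝ} (hχ : ∀ a, LipProfile (χ a) (κ a) (Lχ a)) {N₀ : ℕ} {n : ℕ → ℕ}
    {NW₀ : ι₀ → ℕ} (hNW : ∀ K, ∀ τ' ∈ T₀ K, NW₀ τ' ≤ K) {m₀ : ℕ → ι₀ → ℕ} {slot₀ : ℕ → ι₀ → ℕ → Σ _ : ℕ, ℕ}
    (hwin : ∀ K, ∀ τ' ∈ T₀ K, ∀ i < m₀ K τ', slot₀ K τ' i ∈ (range (N₀ + 1)).sigma fun a => range (n a))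
    (hband : ∀ K, ∀ τ' ∈ T₀ K, ∀ i < m₀ K τ', (slot₀ K τ' i).1 ≤ K)
    (hinj : ∀ K, ∀ τ' ∈ T₀ K, ∀ j < m₀ K τ', ∀ j' < m₀ K τ', slot₀ K τ' j = slot₀ K τ' j' → j = j')
    {fpol : ℕ → ι₀ → ℕ → Pol} {θ₀ : ℕ → ι₀ → ℕ → ℝ} (hmin : 0 < θmin) (hθf : ThresholdFloor T₀ m₀ θ₀ θmin)
    {vA vB : (K : ℕ) → (τ' : ι₀) → ℕ → GaugeField (F.P (NW₀ τ')) 0 (SU N) → ℝ}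
    (hvm : ∀ K, ∀ τ' ∈ T₀ K, ∀ i < m₀ K τ', Measurable (vA K τ' i) ∧ Measurable (vB K τ' i))
    (hloc : LocalRate R C ϑ) (hC : 0 ≤ C) (hϑ0 : 0 ≤ ϑ) (hϑ1 : ϑ < 1)
    (hR : ReadsLevels R T₀ (fun _ τ' => fieldMeasure (F.P (NW₀ τ')) 0 (SU N)) m₀ slot₀ vA vB)
    {RA : (K : ℕ) → ℝ → ι₀ → GaugeField (F.P K) 0 (SU N) → ℝ}
    {RB : (K : ℕ) → ℝ → ι₀ → GaugeField (F.P (K + 1)) 0 (SU N) → ℝ}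
    (hRA0 : ∀ K t, |t| ≤ l₀ → ∀ τ' ∈ T₀ K, 0 ≤ᵐ[fieldMeasure (F.P K) 0 (SU N)] RA K t τ')
    (hRAi : ∀ K t, |t| ≤ l₀ → ∀ τ' ∈ T₀ K, Integrable (RA K t τ') (fieldMeasure (F.P K) 0 (SU N)))
    (hRB0 : ∀ K t, |t| ≤ l₀ → ∀ τ' ∈ T₀ K, 0 ≤ᵐ[fieldMeasure (F.P (K + 1)) 0 (SU N)] RB K t τ')
    (hRBi : ∀ K t, |t| ≤ l₀ → ∀ τ' ∈ T₀ K, Integrable (RB K t τ') (fieldMeasure (F.P (K + 1)) 0 (SU N)))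
    {Bad : ℕ → ℝ → Finset (ι₀ × Finset ℕ)} {W : ℕ → ℝ}
    (hW : RelWeightBound l₀ (layerT₂ T₀ m₀) (layerX₂ F χ NW₀ m₀ m₀ slot₀ fpol θ₀ vA (fun K => K) RA)
      (layerX₂ F χ NW₀ m₀ m₀ slot₀ fpol θ₀ vB (fun K => K + 1) RB) Bad W)
    {Cc Rr CcRec RrRec : ℕ → ℝ → ι₀ × Finset ℕ → ℝ} {ν u s₂ c₀ r s : ℕ → ℝ}
    (hswL : ∀ K t, |t| ≤ l₀ → ∀ τ ∈ layerT₂ T₀ m₀ K \ Bad K t,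
      (∀ᵐ V ∂fieldMeasure (F.P (NW₀ τ.1)) 0 (SU N),
        (∀ i < m₀ K τ.1, facAt χ (slot₀ K τ.1) (layerPol₂ m₀ fpol K τ) (θ₀ K τ.1) (fun j => vA K τ.1 j V) i ≠ 0 ∧
            facAt χ (slot₀ K τ.1) (layerPol₂ m₀ fpol K τ) (θ₀ K τ.1) (fun j => vB K τ.1 j V) i ≠ 0) →
          Real.exp (Cc K t τ - Rr K t τ) *
              (oldDensity F (expMeanLogSU : LoopAverage (SU N)) K (NW₀ τ.1) (RA K t τ.1) V : ℝ) ≤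
            (oldDensity F (expMeanLogSU : LoopAverage (SU N)) (K + 1) (NW₀ τ.1) (RB K t τ.1) V : ℝ)) ∧
      (∀ᵐ V ∂fieldMeasure (F.P (NW₀ τ.1)) 0 (SU N),
        (∀ i < m₀ K τ.1, facAt χ (slot₀ K τ.1) (layerPol₂ m₀ fpol K τ) (θ₀ K τ.1) (fun j => vA K τ.1 j V) i ≠ 0 ∧
            facAt χ (slot₀ K τ.1) (layerPol₂ m₀ fpol K τ) (θ₀ K τ.1) (fun j => vB K τ.1 j V) i ≠ 0) →
          (oldDensity F (expMeanLogSU : LoopAverage (SU N)) (K + 1) (NW₀ τ.1) (RB K t τ.1) V : ℝ) ≤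
            Real.exp (Cc K t τ + Rr K t τ) *
              (oldDensity F (expMeanLogSU : LoopAverage (SU N)) K (NW₀ τ.1) (RA K t τ.1) V : ℝ)))
    (huv : ∀ K t, |t| ≤ l₀ → ∀ τ ∈ layerT₂ T₀ m₀ K \ Bad K t, |Cc K t τ - (CcRec K t τ + ν K)| ≤ vol * s₂ K)
    (hur : ∀ K t, |t| ≤ l₀ → ∀ τ ∈ layerT₂ T₀ m₀ K \ Bad K t, Rr K t τ ≤ RrRec K t τ + vol * u K)
    (hrr : ∀ K t, |t| ≤ l₀ → ∀ τ ∈ layerT₂ T₀ m₀ K \ Bad K t, RrRec K t τ ≤ vol * r K)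
    (hdev : ∀ K t, |t| ≤ l₀ → ∀ τ ∈ layerT₂ T₀ m₀ K \ Bad K t, |CcRec K t τ - c₀ K| ≤ vol * s K)
    (hr : Summable r) (hu : Summable u) (hs : Summable s) (hs₂ : Summable s₂) :
    ∃ K₀, HybridNE7 l₀ vol (fun K => layerT₂ T₀ m₀ (K₀ + K))
      (fun K => layerX₂ F χ NW₀ m₀ m₀ slot₀ fpol θ₀ vA (fun K => K) RA (K₀ + K))
      (fun K => layerX₂ F χ NW₀ m₀ m₀ slot₀ fpol θ₀ vB (fun K => K + 1) RB (K₀ + K))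
      (fun K => Bad (K₀ + K)) (fun K => W (K₀ + K))
      (fun K => shellW χ (fun _ τ => fieldMeasure (F.P (NW₀ τ.1)) 0 (SU N)) (layerM₂ m₀) (layerSlot₂ slot₀)
        (layerPol₂ m₀ fpol) (layerThr θ₀) (layerVar₂ vA) (layerVar₂ vB)
        (fun K t τ V => (oldDensity F (expMeanLogSU : LoopAverage (SU N)) K (NW₀ τ.1) (layerRem RA K t τ) V : ℝ)) (K₀ + K))
      (fun K => shellW χ (fun _ τ => fieldMeasure (F.P (NW₀ τ.1)) 0 (SU N)) (layerM₂ m₀) (layerSlot₂ slot₀)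
        (layerPol₂ m₀ fpol) (layerThr θ₀) (layerVar₂ vB) (layerVar₂ vA)
        (fun K t τ V => (oldDensity F (expMeanLogSU : LoopAverage (SU N)) (K + 1) (NW₀ τ.1) (layerRem RB K t τ) V : ℝ))
        (K₀ + K))
      (fun K => ∑ a ∈ range (N₀ + 1), (n a : ℝ) * lipWeight Lχ (fun _ => 2) (geomWidth C θmin ϑ) a (K₀ + K))
      (fun K => (r (K₀ + K) + u (K₀ + K)) + (s (K₀ + K) + s₂ (K₀ + K))) :=
  have hθ : ∀ K, ∀ τ' ∈ T₀ K, ∀ i < m₀ K τ', 0 < θ₀ K τ' i := hθf.thr_pos hmin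
  hybridNE7_tail_patterned_of_localRate_coreW F hχ hNW hwin hband hinj hmin hθf hvm hloc hC hϑ0 hϑ1 hR hRA0 hRAi hRB0 hRBi
    hW (reindexedBudget_coreW_of_local (termRepr_window_layer_A F hχ hNW hwin hband hθ hvm hRA0 hRAi)
      (termRepr_window_layer_B F hχ hNW hwin hband hθ hvm hRB0 hRBi) hswL huv hur hrr hdev) hr hu hs hs₂

end Layer

end Summit.QuantumFields.BalabanUV.T4Continuum.NE7cSmoothingLocalSocket

end
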